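import Literature.Computability.Complexity.DTIMESubsetNTIME
import Literature.Computability.Complexity.NTIMEHierarchyClock
import HarnessLib

/-!
# `DTIME t ⊆ NTIME t` for every `t ≥ id`, via a linear-time pair clock

Literature / complexity toolkit (theorems only; no notion, definition of a mathematical object or
named fact is introduced).
`DTIMESubsetNTIME.lean` proves `DTIME T ⊆ NTIME t` in the tree's one-constant verifier form of
`NTIME` (`Nondeterministic.lean`) only when `t` dominates every POLYNOMIAL
(`DTIME_subset_NTIME_of_dominated`), because its clock `x ↦ ⟨x, ε⟩` ("keep nothing of the
certificate") comes from the `FP` bricks, whose running time is a polynomial of unspecified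
degree; so even `DTIME(n) ⊆ NTIME(n)` — Arora–Barak 2009, Claim 2.4 / §2.1.2: deterministic time
IS nondeterministic time — was missing at linear and polynomial levels. This file supplies the
clock with an exact linear step count and draws the consequences:

* `PairNilClock.runs_prog`, `PairNilClock.exists_machine` — the stack program
  `x ↦ ⟨x, ε⟩ = boolPair x []` (written out as a term, not named) in `7 |x| + 4` cost units (`SymbolPrograms.lean` discipline:
  `pour`, two pushes, a doubling loop), hence a `TM2` machine within `7 |x| + 5` steps
  (`ACom.exists_computesInTime`);
* `mem_NTIME_of_timeDecidable_linear` — if `L` is decided within `T n` steps and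
  `T n + 14 n + 21 ≤ b · t n + b`, then `L ∈ NTIME t` (the verifier `truncMapAux N ⨟ M` of
  `mem_NTIME_of_timeDecidable`, with the linear clock: it discards the certificate two symbols per
  step, `outputsWithin_truncMapAux_boolPair`, then decides `x` behind the pair projection,
  `outputsWithin_boolUnpairFstLift`; constant `2b + 2`);
* **`DTIME_subset_NTIME_of_le`**: `T ≤ t` and `id ≤ t` pointwise imply `DTIME T ⊆ NTIME t`;
  **`DTIME_subset_NTIME`**: `DTIME t ⊆ NTIME t` for every `t ≥ id`; the instances
  `DTIME_id_subset_NTIME_id : DTIME(n) ⊆ NTIME(n)`, `DTIME_pow_subset_NTIME_pow` (`k ≥ 1`);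
* `DTIME_id_ssubset_NTIME_id_of_not_subset` — with the Paul–Pippenger–Szemerédi–Trotter separation
  `NTIME(n) ⊄ DTIME(n)` (vendored as the named fact `PaulEtAl1983_NTIME_not_subset_DTIME`,
  `PaulPippengerSzemerediTrotter1983.lean`; hypothesis stated here in unfolded form) this gives the
  printed shape `DTIME(n) ⊊ NTIME(n)` over the tree's classes.

## References

* S. Arora, B. Barak, *Computational Complexity: A Modern Approach*, CUP 2009, Claim 2.4
  (`P ⊆ NP`: "take `u` an empty string"), Def. 2.1 / Thm. 2.6 (§2.1.2, verifier form of
  nondeterministic time), §1.3 (several stack operations per step) [AroraBarakCC2009].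
* W. J. Paul, N. Pippenger, E. Szemerédi, W. T. Trotter, *On determinism versus non-determinism
  and related problems*, FOCS 1983, 429–438 [PaulEtAl1983]; S. Homer, A. L. Selman,
  *Computability and Complexity Theory*, Springer 2011, §5.2 [HomerSelman2011].
-/

namespace Literature.Computability.Complexity

open _root_.Computability Turing Polynomial

/-! ### The linear-time clock `x ↦ ⟨x, ε⟩` -/

namespace PairNilClock

open ACom UnaryClock

/-! The pair-with-nothing program `x ↦ boolPair x [] = (bits of x doubled) 0 1` is the term
`pour .inp .xr ;; push .out true ;; push .out false ;; loop .xr fun b => push .out b ;; push .out b`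
(reverse the input onto `xr`; push the separator — `1`, then `0` on top of it; pop `xr`, last
symbol of `x` first, pushing each symbol twice, which restores the order), over the registers
`UnaryClock.Rg` (only `inp`, `xr`, `out` are used). It is written out in the two statements below
rather than named (no definition is introduced). -/

/-- Effect and cost of the doubling loop: from `xr = r`, `out = o` to `xr = ε`,
`out = (r.reverse doubled) ++ o`, in `4 |r| + 1` steps. [folklore] -/
theorem runs_dbl (r o : List Bool) :
    Runs (loop Rg.xr fun b => push .out b ;; push .out b) (mk [] r [] [] [] o)
      (mk [] [] [] [] [] ((r.reverse.flatMap fun b => [b, b]) ++ o)) (4 * r.length + 1) := by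
  have h := runs_loop_inv (k := Rg.xr) (f := fun b => push .out b ;; push .out b)
    (fun done rest => mk [] rest [] [] [] ((done.flatMap fun b => [b, b]) ++ o))
    (fun _ _ => True) 2
    (fun _ _ _ => rfl)
    (fun done a rest _ => ⟨trivial, by
      refine ((Runs.push' rfl).seq (Runs.push' ?_)).of_eq rfl (by norm_num)
      simp [List.flatMap_cons]⟩)
    r [] trivial
  simpa using h

/-- **Effect and cost of the pair-with-nothing program**: `x ↦ boolPair x []` in `7 |x| + 4`
steps. [cite: AroraBarakCC2009, §0.1 (pairing) and Claim 2.4] -/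
theorem runs_prog (x : List Bool) :
    Runs (pour .inp .xr ;; push .out true ;; push .out false ;;
        loop .xr fun b => push .out b ;; push .out b : Prog)
      (AStore.single .inp x) (AStore.single .out (boolPair x [])) (7 * x.length + 4) := by
  rw [single_inp, single_out]
  have h1 := runs_pour (Γ := Bool) (a := Rg.inp) (b := Rg.xr) (by decide) (mk x [] [] [] [] [])
  simp only [mk_inp, mk_xr, List.append_nil, update_mk_inp, update_mk_xr] at h1
  have h2 : Runs (push Rg.out true) (mk [] x.reverse [] [] [] [])
      (mk [] x.reverse [] [] [] [true]) 1 := Runs.push' (by simp)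
  have h3 : Runs (push Rg.out false) (mk [] x.reverse [] [] [] [true])
      (mk [] x.reverse [] [] [] [false, true]) 1 := Runs.push' (by simp)
  have h4 := runs_dbl x.reverse [false, true]
  simp only [List.reverse_reverse, List.length_reverse] at h4
  refine (h1.seq (h2.seq (h3.seq h4))).of_eq ?_ (by omega)
  simp [boolPair]

/-- **The linear pair clock**: some `TM2` machine maps every `x` to `boolPair x []` within
`7 |x| + 5` steps. [cite: AroraBarakCC2009, Claim 2.4] -/
theorem exists_machine : ∃ N : TM2ComputableAux Bool Bool, ∀ x : List Bool,
    N.OutputsWithin x (boolPair x []) (7 * x.length + 5) := by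
  obtain ⟨N, hN⟩ := ACom.exists_computesInTime
    (pour .inp .xr ;; push .out true ;; push .out false ;;
      loop .xr fun b => push .out b ;; push .out b : Prog)
    .inp .out (id : List Bool → List Bool) id
    (fun x => boolPair x []) (fun x => 7 * x.length + 4) runs_prog
  exact ⟨N, fun x => hN x⟩

end PairNilClock

/-! ### Deterministic deciders as verifiers, at every level `t ≥ id` -/

/-- **A deterministic decider is a verifier that discards its certificate — linear version**
(Arora–Barak 2009, Claim 2.4, in the tree's one-constant verifier form of `NTIME`): if `L` is
decided within `T n` steps on inputs of length `n` and `T n + 14 n + 21 ≤ b · t n + b` for all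
`n`, then `L ∈ NTIME t`. Verifier: the truncating wrapper `truncMapAux N` (`TruncMapMachine.lean`)
of the LINEAR clock `N : x ↦ ⟨x, ε⟩` (`PairNilClock.exists_machine`, `7 n + 5` steps) — on
`⟨x, y⟩` it outputs `⟨x, ε⟩` within `12 n + |y| / 2 + 16` steps, reading the discarded certificate
two symbols per step — followed by the decider behind the pair projection (`boolUnpairFstLift`,
`T n + 2 n + 5` steps); relation `R x y = [x ∈ L]`, witness `ε`, constant `2 b + 2`.
[cite: AroraBarakCC2009, Claim 2.4] -/
theorem mem_NTIME_of_timeDecidable_linear {L : Language Bool} {T t : ℕ → ℕ}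
    (hL : TimeDecidable id L T) {b : ℕ} (hb : ∀ n, T n + 14 * n + 21 ≤ b * t n + b) :
    L ∈ NTIME t := by
  obtain ⟨M, hM⟩ := hL
  obtain ⟨N, hN⟩ := PairNilClock.exists_machine
  -- the verifier: truncate the witness to nothing, then decide `x`
  let V : TM2ComputableAux Bool Bool := (truncMapAux N).comp (boolUnpairFstLift M)
  refine ⟨2 * b + 2, fun x _ => L.boolIndicator x, V, fun x y hy => ?_, fun x => ?_⟩
  · -- running time on an admissible pair
    have h₁ := outputsWithin_truncMapAux_boolPair N (y := y) (hN x)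
    simp only [List.length_nil, List.take_zero, mul_zero, add_zero] at h₁
    have h₂ : (boolUnpairFstLift M).OutputsWithin (boolPair x [])
        (encodeBool (L.boolIndicator x)) (T x.length + ((boolPair x []).length + 3)) := by
      refine outputsWithin_boolUnpairFstLift M ?_
      have := hM x
      simpa using this
    have h := Turing.TM2ComputableAux.comp_outputsWithin _ _ h₁ h₂
    refine h.mono ?_
    have hbn := hb x.length
    have hlen : (boolPair x ([] : List Bool)).length = 2 * x.length + 2 := by simp
    rw [hlen]
    have hy2 : 2 * (y.length / 2) ≤ (2 * b + 2) * t x.length + (2 * b + 2) :=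
      (Nat.mul_div_le y.length 2).trans hy
    nlinarith [hbn, hy2]
  · -- correctness: the empty witness
    have hiff : x ∈ L ↔ L.boolIndicator x = true :=
      Set.mem_iff_boolIndicator (L : Set (List Bool)) x
    exact ⟨fun h => ⟨[], Nat.zero_le _, hiff.1 h⟩, fun ⟨_, _, h⟩ => hiff.2 h⟩

/-- **`DTIME T ⊆ NTIME t` whenever `T ≤ t` and `id ≤ t` pointwise** (Arora–Barak 2009, Claim 2.4 /
§2.1.2: `DTIME(T) ⊆ NTIME(T)`, and `NTIME` grows with the bound): a `c · T + c` decider satisfies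
`(c T n + c) + 14 n + 21 ≤ (c + 14) t n + (c + 21)`. [cite: AroraBarakCC2009, Claim 2.4] -/
theorem DTIME_subset_NTIME_of_le {T t : ℕ → ℕ} (hT : ∀ n, T n ≤ t n) (hid : ∀ n, n ≤ t n) :
    DTIME T ⊆ NTIME t := by
  rintro L ⟨c, hL⟩
  refine mem_NTIME_of_timeDecidable_linear (b := c + 35)
    (show TimeDecidable id L (fun n => c * T n + c) from hL) fun n => ?_
  have h1 := Nat.mul_le_mul_left c (hT n)
  have h2 := hid n
  nlinarith [h1, h2]

/-- **`DTIME t ⊆ NTIME t` for every `t ≥ id`** (Arora–Barak 2009, Claim 2.4 / §2.1.2: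
deterministic time is nondeterministic time; the hypothesis `n ≤ t n` is the tree's standing
convention — a `TM2` machine must read its input, `TimeClass t = ∅` for sublinear `t`).
[cite: AroraBarakCC2009, Claim 2.4] -/
theorem DTIME_subset_NTIME {t : ℕ → ℕ} (hid : ∀ n, n ≤ t n) : DTIME t ⊆ NTIME t :=
  DTIME_subset_NTIME_of_le (fun _ => le_rfl) hid

/-- **`DTIME(n) ⊆ NTIME(n)`**: deterministic linear time is nondeterministic linear time, in the
tree's classes. [cite: AroraBarakCC2009, Claim 2.4] -/
theorem DTIME_id_subset_NTIME_id : DTIME (fun n => n) ⊆ NTIME (fun n => n) :=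
  DTIME_subset_NTIME fun _ => le_rfl

/-- `DTIME(nᵏ) ⊆ NTIME(nᵏ)` for `k ≥ 1`. [cite: AroraBarakCC2009, Claim 2.4] -/
theorem DTIME_pow_subset_NTIME_pow {k : ℕ} (hk : 1 ≤ k) :
    DTIME (fun n => n ^ k) ⊆ NTIME (fun n => n ^ k) :=
  DTIME_subset_NTIME fun n => by
    rcases Nat.eq_zero_or_pos n with rfl | hn
    · exact Nat.zero_le _
    · calc n = n ^ 1 := (pow_one n).symm
        _ ≤ n ^ k := Nat.pow_le_pow_right hn hk

/-- **`DTIME(n) ⊊ NTIME(n)` from the Paul–Pippenger–Szemerédi–Trotter separation.** With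
`NTIME(n) ⊄ DTIME(n)` (Paul–Pippenger–Szemerédi–Trotter 1983 for multitape machines, transferred
to the tree's classes: the named fact `PaulEtAl1983_NTIME_not_subset_DTIME`, whose statement is
the hypothesis below verbatim) and `DTIME(n) ⊆ NTIME(n)` (`DTIME_id_subset_NTIME_id`), the
inclusion is strict — the printed shape "`DTIME(n)` is properly contained in `NTIME(n)`"
(Homer–Selman 2011, §5.2). [cite: PaulEtAl1983, main theorem] [cite: HomerSelman2011, §5.2] -/
theorem DTIME_id_ssubset_NTIME_id_of_not_subset
    (h : ¬ (NTIME (fun n => n) ⊆ DTIME (fun n => n))) :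
    DTIME (fun n => n) ⊂ NTIME (fun n => n) :=
  ⟨DTIME_id_subset_NTIME_id, h⟩

end Literature.Computability.Complexity
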